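import Summits.AtomisticToContinuum.Crystallization.Theses.DisclinationRation

/-!
# Birth skeleton (BC3) — crux `BarlowLiouville` (item `stmt-AtomisticToContinuum-15801`)

Route `route-AtomisticToContinuum-DisclinationRation` (crux K3, rank 6). Published as
`Cruxes/BarlowLiouville/Lines/birth.lean`.

The crux (verbatim decl
`Summit.AtomisticToContinuum.Crystallization.Theses.DisclinationRation.BarlowLiouville`):
given the uniform polytype stability `UniformPolytypeStability` (K4), for every sequence `x` of
Lennard-Jones ground states in `ℝ³`, every `δ`-separated, relatively dense hull element `X` of `x`
(two-way matching of translates of a subsequence with `X` on every ball) all of whose points are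
`1/20`-{fcc,hcp}-good and which is Barlow-templated (`Set.BijOn Φ (barlowStacking 1 √(2/3) s) X`, `Φ`
locally `1/20`-near similarities) yields LAYERED WINDOWS OF `x` AT EVERY SCALE: one in-layer spacing
`a ∈ [47/50, 1]` such that for every `R`, `ε > 0`, frequently in `N`, `x N + t` is two-way `ε`-matched
on `B_R(0)` with a rigid image `A · L(a, s, z)` of a relaxed layered set (free Hägg word `s`, free
spacings `z` in the box `[39a/50, 17a/20]`) — the hypothesis of `PeriodicGivenLayered` (stmt-11779).

## The line — the typed crux needs WINDOWS, not global exactness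

The informal K3 ("`X` IS a rigid motion of an exact relaxed layered set") is stronger than what the
typed conclusion consumes: windows of `x` only need, at every scale `R` and tolerance `η`, ONE
translate of `X` that is `η`-near a layered patch on `B_R(0)`. The skeleton isolates exactly that:

* `stub_patches` — NEAR-LAYERED PATCHES AT EVERY SCALE (the heart, size XL; "strain density zero
  at every tolerance" of the route's two-layer plan, read off at one patch per scale): under the
  crux hypotheses, `∀ R η > 0 ∃ a ∈ [47/50,1] ∃ A t s z` (Hägg word, box spacings) with `X + t`
  two-way `η`-matched with `A · L(a,s,z)` on `B_R(0)`. Intended engine: hull elements are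
  bulk-optimal (`hullBulkOptimal_proof`, stmt-12090) canonical GSCs (`localLimitStable_proof`,
  stmt-14086); template + everywhere-good ⇒ a piecewise-affine chart `1/20`-near the layered family
  on every unit cluster; K4 (uniform phonon stability of every relaxed polytype) makes the excess
  energy on `B_L` control the squared distance of the chart from the layered family; bulk
  optimality makes the excess `o(L³)`; averaging gives, for every fixed `R`, an `R`-ball of excess
  `o(1)`, i.e. an `η`-near-layered patch. No global Liouville / unique-continuation step is needed.
* `stub_uniformSpacing` — ONE SPACING FOR ALL SCALES (size M, pure geometry of the layered family):
  `Patches X → UniformPatches X`. Compactness of `[47/50, 1]` (a subsequence of the spacings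
  `a_k` of the patches at `(R, η) = (k, 1/k)` converges to `a⋆`) and DILATION COVARIANCE of the
  family, `λ • L(a, s, z) = L(λa, s, λz)` (`triangularVec₁ a = (a,0,0)`, `triangularVec₂ a`,
  `barlowOffset a` are linear in `a`; the box `[39a/50, 17a/20]` scales with `a`), so the patch at
  level `k`, dilated by `λ = a⋆/a_k → 1`, is an `(1/k + |λ - 1|(2R + 1))`-patch of spacing `a⋆` on
  `B_R`. This is the remark "`∃ a` outside the `(R, ε)` quantifiers is equivalent to choosing `a`
  per window" of the `LayeredWindows` docstring (stmt-11778), made a lemma.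
* `stub_transfer` — HULL BOOKKEEPING (size M): `Hull x X → UniformPatches X → LW x`. For `(R, ε)`
  take the patch of `X` at radius `R + ε` and tolerance `ε/2` (translation `t`), the hull matching
  of `x (φ j) + τ j` with `X` at radius `R + ‖t‖ + ε/2` and tolerance `ε/2` (eventually in `j`),
  compose translations (`τ j + t`) and the two triangle inequalities; `StrictMono φ` turns
  "eventually in `j`" into "frequently in `N`" (`StrictMono.tendsto_atTop`, `Tendsto.frequently`).
* `composition` (explicit hypotheses = the three stub signatures, no `sorry`) and
  `BarlowLiouville_of : <the crux BY NAME> := …composition stub_patches stub_uniformSpacing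
  stub_transfer…` (the `ledger skeleton check` shape).

Disproof used: none on file (`ledger crux ls stmt-AtomisticToContinuum-15801`: no workfiles,
2026-08-17) — no `_false_without_` obstruction, no refuted strengthening recorded. Negatives
honoured (`ledger negatives --problem AtomisticToContinuum`, 20 entries): no stub is a gluing of
grains of a periodic configuration (OneGrainGluing 3506) or a count-only shell inference
(4146-type); every configuration quantified over is `δ`-separated or a hull element.
-/

noncomputable section

namespace Summit.AtomisticToContinuum.Crystallization.Cruxes.BarlowLiouville.Birth

open Literature.MathematicalPhysics.StatisticalMechanics Literature.Geometry.DiscreteGeometry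
open Summit.AtomisticToContinuum.Crystallization.Theses.DisclinationRation (UniformPolytypeStability)

/-- Euclidean `3`-space. -/
local notation "E3" => EuclideanSpace ℝ (Fin 3)

/-! ### The inlined predicates of the crux, named (all unfold definitionally to the crux text) -/

/-- Nearest-neighbour distance `d(y) = inf {dist z y : z ∈ S, z ≠ y}` (the crux's `let d`). -/
def nnd (S : Set E3) (y : E3) : ℝ := sInf ((fun z => dist z y) '' (S \ {y}))

/-- The first shell of `y` in `S`: the other points of `S` within `13/10 · d(y)` (the crux's
`let T`). -/
def shell (S : Set E3) (y : E3) : Set E3 :=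
  {z : E3 | z ∈ S ∧ z ≠ y ∧ dist z y < 13 / 10 * nnd S y}

/-- `y` is `1/20`-{fcc,hcp}-good in `S` (the crux's `let GF`, pointwise). -/
def Good (S : Set E3) (y : E3) : Prop :=
  ∃ A : E3 →ₗᵢ[ℝ] E3,
    (∃ e : ↥(shell S y) ≃ ↥fccKissingPattern, ∀ t : ↥(shell S y),
        dist ((nnd S y)⁻¹ • ((t : E3) - y)) (A ((e t : ↥fccKissingPattern) : E3)) ≤ 1 / 20) ∨
    (∃ e : ↥(shell S y) ≃ ↥hcpKissingPattern, ∀ t : ↥(shell S y),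
        dist ((nnd S y)⁻¹ • ((t : E3) - y)) (A ((e t : ↥hcpKissingPattern) : E3)) ≤ 1 / 20)

/-- `S` is `δ`-separated (verbatim the crux's hypothesis). -/
def Sep (δ : ℝ) (S : Set E3) : Prop := ∀ y ∈ S, ∀ z ∈ S, y ≠ z → δ ≤ dist y z

/-- `S` is relatively dense (verbatim the crux's hypothesis). -/
def Dense (S : Set E3) : Prop := ∃ R₁ : ℝ, ∀ p : E3, ∃ y ∈ S, dist y p ≤ R₁

/-- Sequences of finite configurations `x N : Fin N → ℝ³`. -/
abbrev Cfg : Type := (N : ℕ) → (Fin N → E3)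

/-- Every `x N` is a Lennard-Jones ground state (verbatim the crux's hypothesis). -/
def GS (x : Cfg) : Prop := ∀ N, IsGroundState lennardJones (x N)

/-- `S` is a hull element of `x` (the crux's `let HL`): translates of a subsequence are two-way
matched with `S` on every ball, eventually. -/
def Hull (x : Cfg) (S : Set E3) : Prop :=
  ∃ φ : ℕ → ℕ, StrictMono φ ∧ ∃ τ : ℕ → E3, ∀ R ε : ℝ, 0 < ε → ∀ᶠ j : ℕ in Filter.atTop,
    (∀ s ∈ S, ‖s‖ ≤ R → ∃ i : Fin (φ j), dist (x (φ j) i + τ j) s ≤ ε) ∧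
    (∀ i : Fin (φ j), ‖x (φ j) i + τ j‖ ≤ R → ∃ s ∈ S, dist (x (φ j) i + τ j) s ≤ ε)

/-- `X` is Barlow-templated (verbatim the conclusion of `RobustBarlowTemplate`, the crux's last
hypothesis). -/
def Templated (X : Set E3) : Prop :=
  ∃ s : ℤ → ℤ, IsHaggSeq s ∧ ∃ Φ : E3 → E3,
    Set.BijOn Φ (barlowStacking 1 (Real.sqrt (2 / 3)) s) X ∧
    ∀ p ∈ barlowStacking 1 (Real.sqrt (2 / 3)) s, ∃ A : E3 →ₗᵢ[ℝ] E3, ∃ l : ℝ, 0 < l ∧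
      ∀ q ∈ barlowStacking 1 (Real.sqrt (2 / 3)) s, dist q p ≤ 1 →
        dist (Φ q) (Φ p + l • A (q - p)) ≤ 1 / 20 * l

/-- The spacing box of the relaxed layered family: increments of `z` in `[39a/50, 17a/20]`. -/
def Box (a : ℝ) (z : ℤ → ℝ) : Prop :=
  ∀ m : ℤ, 39 / 50 * a ≤ z (m + 1) - z m ∧ z (m + 1) - z m ≤ 17 / 20 * a

/-- The relaxed layered set `A · L(a, s, z)`: triangular layers of spacing `a`, hole registry
`haggLabel s`, heights `z`, rotated by the linear isometry `A` (the crux's `let S`). -/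
def layered (A : E3 →ₗᵢ[ℝ] E3) (a : ℝ) (s : ℤ → ℤ) (z : ℤ → ℝ) : Set E3 :=
  {p | ∃ m i j : ℤ, p = A (((i : ℝ) • triangularVec₁ a) + ((j : ℝ) • triangularVec₂ a) +
    ((haggLabel s m : ℝ) • barlowOffset a) + (z m • layerNormal 1))}

/-- Two-way matching of the translated finite configuration `y + t` with `S` on `B_R(0)` at
precision `ε` (the crux's window clause). -/
def WinMatch {N : ℕ} (y : Fin N → E3) (t : E3) (S : Set E3) (R ε : ℝ) : Prop :=
  (∀ p ∈ S, ‖p‖ ≤ R → ∃ i : Fin N, dist (y i + t) p ≤ ε) ∧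
  (∀ i : Fin N, ‖y i + t‖ ≤ R → ∃ p ∈ S, dist (y i + t) p ≤ ε)

/-- LAYERED WINDOWS of `x` at every scale — the crux's conclusion (the `LayeredWindows` /
`PeriodicGivenLayered` format, stmt-11778/11779). -/
def LW (x : Cfg) : Prop :=
  ∃ a : ℝ, 47 / 50 ≤ a ∧ a ≤ 1 ∧ ∀ R ε : ℝ, 0 < ε → ∃ᶠ N in Filter.atTop,
    ∃ (A : E3 →ₗᵢ[ℝ] E3) (t : E3) (s : ℤ → ℤ) (z : ℤ → ℝ),
      IsHaggSeq s ∧ Box a z ∧ WinMatch (x N) t (layered A a s z) R ε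

/-! ### The intermediate objects of the line -/

/-- Two-way matching of the translate `X + t` with `S` on `B_R(0)` at precision `η`. -/
def PatchMatch (X : Set E3) (t : E3) (S : Set E3) (R η : ℝ) : Prop :=
  (∀ p ∈ S, ‖p‖ ≤ R → ∃ q ∈ X, dist (q + t) p ≤ η) ∧
  (∀ q ∈ X, ‖q + t‖ ≤ R → ∃ p ∈ S, dist (q + t) p ≤ η)

/-- NEAR-LAYERED PATCHES AT EVERY SCALE (conclusion of `stub_patches`): for every radius `R` and
tolerance `η > 0` some translate of `X` is two-way `η`-matched on `B_R(0)` with a rigid image of a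
relaxed layered set; the spacing `a ∈ [47/50, 1]` may depend on `(R, η)`. -/
def Patches (X : Set E3) : Prop :=
  ∀ R η : ℝ, 0 < η → ∃ a : ℝ, 47 / 50 ≤ a ∧ a ≤ 1 ∧
    ∃ (A : E3 →ₗᵢ[ℝ] E3) (t : E3) (s : ℤ → ℤ) (z : ℤ → ℝ),
      IsHaggSeq s ∧ Box a z ∧ PatchMatch X t (layered A a s z) R η

/-- The same with ONE in-layer spacing `a` for all scales (conclusion of `stub_uniformSpacing`). -/
def UniformPatches (X : Set E3) : Prop :=
  ∃ a : ℝ, 47 / 50 ≤ a ∧ a ≤ 1 ∧ ∀ R η : ℝ, 0 < η →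
    ∃ (A : E3 →ₗᵢ[ℝ] E3) (t : E3) (s : ℤ → ℤ) (z : ℤ → ℝ),
      IsHaggSeq s ∧ Box a z ∧ PatchMatch X t (layered A a s z) R η

/-! ### Registered stubs -/

/-- STUB 1 (XL, load-bearing) — near-layered patches at every scale in a templated,
everywhere-good hull element of Lennard-Jones ground states, given uniform polytype stability. -/
theorem stub_patches :
    UniformPolytypeStability → ∀ x : Cfg, GS x → ∀ δ : ℝ, 0 < δ → ∀ X : Set E3, Sep δ X →
      Hull x X → Dense X → (∀ y ∈ X, Good X y) → Templated X → Patches X := by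
  sorry

/-- STUB 2 (M) — one in-layer spacing serves all scales (compactness of `[47/50, 1]` and
dilation covariance of the relaxed layered family). -/
theorem stub_uniformSpacing : ∀ X : Set E3, Patches X → UniformPatches X := by
  sorry

/-- STUB 3 (M) — patches of a hull element are windows of the sequence, frequently in `N`. -/
theorem stub_transfer : ∀ x : Cfg, ∀ X : Set E3, Hull x X → UniformPatches X → LW x := by
  sorry

/-! ### The composition (kernel-checked, no `sorry`): stubs 1–3 ⟹ the crux -/

/-- COMPOSITION WITH EXPLICIT HYPOTHESES (`stub₁-sig → stub₂-sig → stub₃-sig → crux body`; the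
conclusion is the crux's statement written with the named predicates of this file, to which the
route decl unfolds definitionally, so that `BarlowLiouville_of` below is the ONLY theorem of the
file whose head is the crux name — the `ledger skeleton check` shape). Pure logic. -/
theorem composition
    (h_patches : UniformPolytypeStability → ∀ x : Cfg, GS x → ∀ δ : ℝ, 0 < δ → ∀ X : Set E3,
      Sep δ X → Hull x X → Dense X → (∀ y ∈ X, Good X y) → Templated X → Patches X)
    (h_uniform : ∀ X : Set E3, Patches X → UniformPatches X)
    (h_transfer : ∀ x : Cfg, ∀ X : Set E3, Hull x X → UniformPatches X → LW x) :
    UniformPolytypeStability → ∀ x : Cfg, GS x → ∀ δ : ℝ, 0 < δ → ∀ X : Set E3, Sep δ X →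
      Hull x X → Dense X → (∀ y ∈ X, Good X y) → Templated X → LW x := by
  intro hK x hx δ hδ X hsep hhull hdense hgood htemp
  exact h_transfer x X hhull (h_uniform X (h_patches hK x hx δ hδ X hsep hhull hdense hgood htemp))

/-- THE SKELETON THEOREM: the crux
`Summit.AtomisticToContinuum.Crystallization.Theses.DisclinationRation.BarlowLiouville` concluded
BY NAME (type literally the route decl) from the three DECLARED stubs through the sorry-free
`composition`; `sorry` lives only inside `stub_*`. The crux's inlined `let GF / let HL / let S`
clauses are `Good`, `Hull`, `WinMatch … (layered …)` by definitional unfolding. -/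
theorem BarlowLiouville_of :
    Summit.AtomisticToContinuum.Crystallization.Theses.DisclinationRation.BarlowLiouville := by
  intro hK GF HL x hx δ hδ X hsep hhull hdense hgood htemp
  exact composition stub_patches stub_uniformSpacing stub_transfer hK x hx δ hδ X hsep hhull hdense
    hgood htemp

end Summit.AtomisticToContinuum.Crystallization.Cruxes.BarlowLiouville.Birth

end
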